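import Summits.Parity.BatemanHorn.Theorems.RoughValueTransportDefs
import Summits.Parity.BatemanHorn.Theorems.BalancedSemiprimeLayer.Negative.FalseWithoutNoFixedPrimeDivisor
import Literature.NumberTheory.Sieve.ParityWave0Proofs

/-!
# `BalancedSemiprimeLayer` (crux stmt-Parity-9469), line `smooth-modulus-twisted-hooley`:
# the lever `TwistedHooleyDilates` is FALSE at `D = 0`, so `stub_twistedHooley` needs `Irreducible g`
# and `g.natDegree = 2`

Negative-side load-bearing analysis at STUB level (drefute gen 2, refuter-drefute-stmt-Parity-9469-g2-0),
PROVED.  The line's lever (vocabulary `Theorems/RoughValueTransportDefs.lean`)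

  `TwistedHooleyDilates D : ∃ η > 0, ∃ A K, ∀ Q u h M, 0 < Q → h ≠ 0 → 2 ≤ M →
     ‖∑_{m ≤ M, m ≡ u (Q), (m,Q)=1} S_{Q²X²−D}(h; m)‖ ≤ K Q^A |h|^A M^{1−η}`

is consumed by `stub_twistedHooley` only at `D = disc g` for an IRREDUCIBLE QUADRATIC `g` (a non-square,
in particular `D ≠ 0`).  Here: `not_twistedHooleyDilates_zero : ¬ TwistedHooleyDilates 0`.  At `Q = 1`,
`h = 1` the root Weyl sum of `X²` is EXPLICIT: writing `m = b²a` with `a` squarefree, `m ∣ ν² ⇔ ba ∣ ν`,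
so the roots are `ν = ba·j`, `j < b`, and `S_{X²}(1; m) = ∑_{j<b} e(j/b) = [m squarefree]`
(`polyRootWeylSum_X_sq_one`); hence the class sum is the number of squarefree `m ≤ M`, which is at least
`π(M) ∼ M/log M` (prime number theorem, tree: `tendsto_primeCounting_mul_log_div`) and beats every
`K·M^{1−η}`.  Consequences (the two hypotheses of the stub cannot be dropped):

* `stub_twistedHooley_false_without_irreducible` — witness `g = X²` (`natDegree = 2`, `disc = 0`);
* `stub_twistedHooley_false_without_natDegree_two` — witness `g = 2` (irreducible in `ℤ[X]`,
  `discrim (coeff 2) (coeff 1) (coeff 0) = discrim 0 0 2 = 0`).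

(For a NONZERO square `D = s²` the lever is false as well — main term `2cos(2πhsū/Q)·M/Q` from the roots
`±sQ̄`, gen-1 numerics — but a Lean proof would need the equidistribution of the non-trivial square roots;
`D = 0` is the kernel-checkable instance.)
-/

namespace Summit.Parity.BatemanHorn.Theorems.BalancedSemiprimeLayer.Negative

open Filter Finset Polynomial Real
open scoped Topology
open Literature.NumberTheory.Sieve
open Summit.Parity.BatemanHorn.Cruxes.BalancedSemiprimeLayer.SmoothModulusTwistedHooley
  (TwistedHooleyDilates)

/-! ### The root Weyl sum of `X²` at frequency `1` -/

/-- For `a` squarefree: `b²a ∣ ν²` iff `ba ∣ ν`. [folklore] -/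
theorem sq_mul_dvd_sq_iff {a b ν : ℕ} (ha : Squarefree a) (hb : 0 < b) :
    b ^ 2 * a ∣ ν ^ 2 ↔ b * a ∣ ν := by
  constructor
  · intro h
    have hb2 : b ^ 2 ∣ ν ^ 2 := dvd_trans (dvd_mul_right _ _) h
    have hbν : b ∣ ν := (Nat.pow_dvd_pow_iff two_ne_zero).mp hb2
    obtain ⟨ν', rfl⟩ := hbν
    rw [mul_pow] at h
    have ha' : a ∣ ν' ^ 2 := Nat.dvd_of_mul_dvd_mul_left (pow_pos hb 2) h
    exact mul_dvd_mul_left b ((ha.dvd_pow_iff_dvd two_ne_zero).mp ha')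
  · rintro ⟨j, rfl⟩
    exact ⟨a * j ^ 2, by ring⟩

/-- The roots of `X² ≡ 0 (mod b²a)` (`a` squarefree) in `[0, b²a)` are the `ba·j`, `j < b`. [folklore] -/
theorem filter_range_dvd_sq_eq {a b : ℕ} (ha : Squarefree a) (ha0 : 0 < a) (hb : 0 < b) :
    (range (b ^ 2 * a)).filter (fun ν : ℕ => ((b ^ 2 * a : ℕ) : ℤ) ∣ (X ^ 2 : ℤ[X]).eval (ν : ℤ)) =
      (range b).map ⟨fun j => j * (b * a), mul_left_injective₀ (Nat.mul_pos hb ha0).ne'⟩ := by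
  ext ν
  simp only [mem_filter, mem_range, eval_pow, eval_X, Finset.mem_map, Function.Embedding.coeFn_mk]
  rw [← Nat.cast_pow, Int.natCast_dvd_natCast, sq_mul_dvd_sq_iff ha hb]
  constructor
  · rintro ⟨hlt, j, rfl⟩
    refine ⟨j, ?_, by ring⟩
    have : b * a * j < b * a * b := by nlinarith
    exact lt_of_mul_lt_mul_left this (Nat.zero_le _)
  · rintro ⟨j, hj, rfl⟩
    refine ⟨?_, ⟨j, by ring⟩⟩
    have hba : 0 < b * a := Nat.mul_pos hb ha0
    nlinarith

/-- **`S_{X²}(1; m) = [m squarefree]`** for `m ≥ 1`. [folklore] -/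
theorem polyRootWeylSum_X_sq_one {m : ℕ} (hm : 0 < m) :
    polyRootWeylSum (X ^ 2 : ℤ[X]) m 1 = if Squarefree m then 1 else 0 := by
  obtain ⟨a, b, ha0, hb, rfl, ha⟩ := Nat.sq_mul_squarefree_of_pos hm
  rw [polyRootWeylSum, filter_range_dvd_sq_eq ha ha0 hb, Finset.sum_map]
  simp only [Function.Embedding.coeFn_mk, Int.cast_one, one_mul]
  have hb0 : (b : ℂ) ≠ 0 := by exact_mod_cast hb.ne'
  have ha0' : (a : ℂ) ≠ 0 := by exact_mod_cast ha0.ne'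
  have hterm : ∀ j : ℕ, Complex.exp (2 * Real.pi * Complex.I * (((j * (b * a) : ℕ) : ℂ) / ((b ^ 2 * a : ℕ) : ℂ))) =
      Complex.exp (2 * Real.pi * Complex.I / b) ^ j := by
    intro j
    rw [← Complex.exp_nat_mul]
    congr 1
    push_cast
    field_simp
  simp_rw [hterm]
  by_cases hb1 : b = 1
  · subst hb1
    simp [ha]
  · have hb2 : 1 < b := lt_of_le_of_ne hb (Ne.symm hb1)
    have hprim : IsPrimitiveRoot (Complex.exp (2 * Real.pi * Complex.I / b)) b :=
      Complex.isPrimitiveRoot_exp b hb.ne'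
    rw [hprim.geom_sum_eq_zero hb2]
    have hnsq : ¬ Squarefree (b ^ 2 * a) := by
      intro h
      have := h b ⟨a, by ring⟩
      rw [Nat.isUnit_iff] at this
      exact hb1 this
    rw [if_neg hnsq]

/-! ### The class sum at `Q = 1`, `h = 1` counts squarefree numbers -/

/-- At `D = 0`, `Q = 1`, `u = 0`, `h = 1` the lever's class sum is the number of squarefree `m ≤ M`. [folklore] -/
theorem classSum_zero_eq (M : ℕ) :
    ∑ m ∈ (Icc 1 M).filter (fun m : ℕ => m ≡ 0 [MOD 1] ∧ m.Coprime 1),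
        polyRootWeylSum (C (((1 : ℕ) : ℤ) ^ 2) * X ^ 2 - C (0 : ℤ)) m 1 =
      (#((Icc 1 M).filter Squarefree) : ℂ) := by
  have hpoly : (C (((1 : ℕ) : ℤ) ^ 2) * X ^ 2 - C (0 : ℤ) : ℤ[X]) = X ^ 2 := by simp
  have hfilter : (Icc 1 M).filter (fun m : ℕ => m ≡ 0 [MOD 1] ∧ m.Coprime 1) = Icc 1 M :=
    filter_true_of_mem fun m _ => ⟨Nat.modEq_one, Nat.coprime_one_right m⟩
  rw [hpoly, hfilter, Finset.card_eq_sum_ones, Nat.cast_sum, Finset.sum_filter]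
  refine Finset.sum_congr rfl fun m hm => ?_
  rw [polyRootWeylSum_X_sq_one (mem_Icc.mp hm).1]
  split_ifs <;> simp

/-- Primes are squarefree: `π(M) ≤ #{m ≤ M squarefree}`. [folklore] -/
theorem primeCounting_le_card_squarefree (M : ℕ) :
    Nat.primeCounting M ≤ #((Icc 1 M).filter Squarefree) := by
  rw [← Nat.primesLE_card_eq_primeCounting, Nat.primesLE_eq_filter_range]
  refine card_le_card fun p hp => ?_
  simp only [mem_filter, mem_range] at hp
  simp only [mem_filter, mem_Icc]
  exact ⟨⟨hp.2.one_lt.le, by omega⟩, hp.2.prime.squarefree⟩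

/-! ### The refutation at `D = 0` and the two stub mutations -/

/-- **The lever is false at `D = 0`**: `¬ TwistedHooleyDilates 0`. [folklore] -/
theorem not_twistedHooleyDilates_zero : ¬ TwistedHooleyDilates 0 := by
  rintro ⟨η, hη, A, K, H⟩
  -- the bound at Q = 1, u = 0, h = 1: #{squarefree ≤ M} ≤ K·M^{1−η} for all M ≥ 2
  have hbound : ∀ M : ℕ, 2 ≤ M → (Nat.primeCounting M : ℝ) ≤ K * (M : ℝ) ^ (1 - η) := by
    intro M hM
    have h := H 1 0 1 M one_pos one_ne_zero hM
    rw [classSum_zero_eq, Complex.norm_natCast] at h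
    simp only [Nat.cast_one, Real.one_rpow, mul_one, Int.cast_one, abs_one] at h
    exact le_trans (by exact_mod_cast primeCounting_le_card_squarefree M) h
  -- π(M) ≥ M/(2 log M) eventually (PNT)
  have hπ : ∀ᶠ M : ℕ in atTop, 1 / 2 * (M : ℝ) / Real.log M < Nat.primeCounting M :=
    eventually_mul_div_log_lt (a := fun M : ℕ => (Nat.primeCounting M : ℝ))
      tendsto_primeCounting_mul_log_div (by norm_num)
  -- K·M^{1−η} ≤ M/(4 log M) eventually (log M = o(M^η))
  set K' : ℝ := max K 1 with hK'
  have hK'pos : 0 < K' := lt_of_lt_of_le one_pos (le_max_right _ _)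
  have hlo := (isLittleO_log_rpow_atTop hη).comp_tendsto tendsto_natCast_atTop_atTop
  have hsmall : ∀ᶠ M : ℕ in atTop, K * (M : ℝ) ^ (1 - η) ≤ 1 / 4 * (M : ℝ) / Real.log M := by
    filter_upwards [hlo.def (show (0 : ℝ) < 1 / (4 * K') by positivity), eventually_gt_atTop 1]
      with M hM hM1
    have hM' : (1 : ℝ) < M := by exact_mod_cast hM1
    have hMpos : (0 : ℝ) < M := by linarith
    have hlog : 0 < Real.log M := Real.log_pos hM'
    simp only [Function.comp_apply, Real.norm_eq_abs, abs_of_pos hlog,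
      abs_of_pos (Real.rpow_pos_of_pos hMpos η)] at hM
    -- hM : log M ≤ 1/(4K') · M^η
    have hrpow : (M : ℝ) = (M : ℝ) ^ (1 - η) * (M : ℝ) ^ η := by
      rw [← Real.rpow_add hMpos]; norm_num
    have hpos1 : 0 < (M : ℝ) ^ (1 - η) := Real.rpow_pos_of_pos hMpos _
    rw [le_div_iff₀ hlog]
    calc K * (M : ℝ) ^ (1 - η) * Real.log M
        ≤ K' * (M : ℝ) ^ (1 - η) * Real.log M := by
          gcongr; exact le_max_left _ _
      _ ≤ K' * (M : ℝ) ^ (1 - η) * (1 / (4 * K') * (M : ℝ) ^ η) := by gcongr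
      _ = 1 / 4 * ((M : ℝ) ^ (1 - η) * (M : ℝ) ^ η) := by field_simp
      _ = 1 / 4 * (M : ℝ) := by rw [← hrpow]
  obtain ⟨M, hM1, hM2, hM3⟩ := (hπ.and (hsmall.and (eventually_ge_atTop 2))).exists
  have h4 := hbound M hM3
  have hMpos : (0 : ℝ) < M := by exact_mod_cast lt_of_lt_of_le two_pos hM3
  have hlog : 0 < Real.log M := Real.log_pos (by exact_mod_cast lt_of_lt_of_le one_lt_two hM3)
  have : 1 / 4 * (M : ℝ) / Real.log M < 1 / 2 * (M : ℝ) / Real.log M := by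
    rw [div_lt_div_iff_of_pos_right hlog]; linarith
  linarith

/-- **Any proof of `stub_twistedHooley` must use `Irreducible g`**: with that hypothesis dropped the stub
is false (witness `g = X²`, discriminant `0`). [folklore] -/
theorem stub_twistedHooley_false_without_irreducible :
    ¬ ∀ g : ℤ[X], g.natDegree = 2 →
      TwistedHooleyDilates (discrim (g.coeff 2) (g.coeff 1) (g.coeff 0)) := by
  intro h
  have h2 := h (X ^ 2) (natDegree_X_pow 2)
  have hd : discrim ((X ^ 2 : ℤ[X]).coeff 2) ((X ^ 2 : ℤ[X]).coeff 1) ((X ^ 2 : ℤ[X]).coeff 0) = 0 := by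
    simp [discrim, coeff_X_pow]
  rw [hd] at h2
  exact not_twistedHooleyDilates_zero h2

/-- **Any proof of `stub_twistedHooley` must use `g.natDegree = 2`**: with that hypothesis dropped the
stub is false (witness the irreducible constant `g = 2`, `discrim 0 0 2 = 0`). [folklore] -/
theorem stub_twistedHooley_false_without_natDegree_two :
    ¬ ∀ g : ℤ[X], Irreducible g →
      TwistedHooleyDilates (discrim (g.coeff 2) (g.coeff 1) (g.coeff 0)) := by
  intro h
  have h2 := h (C (2 : ℤ)) irreducible_C_two
  have hd : discrim ((C (2 : ℤ) : ℤ[X]).coeff 2) ((C (2 : ℤ) : ℤ[X]).coeff 1)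
      ((C (2 : ℤ) : ℤ[X]).coeff 0) = 0 := by
    simp [discrim]
  rw [hd] at h2
  exact not_twistedHooleyDilates_zero h2

end Summit.Parity.BatemanHorn.Theorems.BalancedSemiprimeLayer.Negative
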